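import Summits.QuantumFields.YangMills.Theorems.BalabanUVNodesK0Stub1FlatChartDImplicit
import Summits.QuantumFields.YangMills.Theorems.UnitScaleTiltProp8ChartHInvComb
import Literature.MathematicalPhysics.QuantumFieldTheory.Balaban1983to89.B13Contraction113
import Literature.MathematicalPhysics.QuantumFieldTheory.Balaban1983to89.B8SectDSource
import Literature.MathematicalPhysics.QuantumFieldTheory.Balaban1983to89.B11Eq115Space
import HarnessLib

/-!
# K0⁷ STUB 1 (`stub_prop8StepCoP13`), S4b ♭ road — **THE IMPLICIT ♭ CHART TAKES VALUES IN EVERY CLOSED INVARIANT VALUE MODULE**: the ♭ PORT of n07-w2's value-module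
# engine `N07ChartDValued.chartD_valued` (single-bar chart of record) to the double-bar chart `chartLogFlat` with FILE α's letters (`R⋆♭ = (60800ℓ²L)⁻¹`, `C₂♭ = 64L∕R⋆♭`,
# window `9C₂♭B₀ε < 1`, `3ε ≤ R⋆♭∕4`)

Cell `pub-ymgap`, width seat `pub-ymgap-k0-s1-w4` g2 (CLAIM-6a, bus 2026-08-28T12:3xZ).  `--kind proof --supports stmt-QuantumFields-20541 --as helper`; count-neutral.
[15] = [Balaban1985Variational].

WHY.  k0-s1-w1's fibre-curve junction reads the dressed ♭ field `A′ − H♭·Dsel♭(A′)` in `SU(N)` (`exp_mem_specialUnitaryGroup_of_mem_lieSU`), i.e. wants it HERMITIAN TRACELESS for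
Hermitian traceless `A′`; k0-s1-w2's `K0Stub1RealityFromCertificate` wants the reality of the ingredients of (80).  p. 286's «simple iteration method» gives both at once for ANY
closed ℝ-submodule `S ⊆ M_N(ℂ)` preserved by `H` and by the remainder `C♭ = Q♭ − Q_lin♭`: the map `X ↦ C♭(A′ − HX)` is a self-map and a `9C₂♭B₀ε`-contraction of the closed ball
`‖X‖ ≤ 4C₂♭ε²` of the sup-normed carrier ([Balaban1988RG2Cluster] p. 5, `B13Contraction113.mapsTo_T ∕ lipschitz_T`), it preserves the closed set of `S`-valued data, and ANY `Dfun`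
obeying (55)♭ + (49)♭ is its fixed point in that ball (`B8SectDSource.fixedPoint_mem_of_invariant`).  This file is the engine; the instance `S = herm0` (Hermitian traceless:
FILE CLAIM-5's `⋆`-symmetry + the determinant through the tower with the `N`-guard) is CLAIM-6b.

WHAT IS PROVED (sorry-free; no definition; axioms standard; generic `P`, fibre `M_N(ℂ)`, `N ≥ 1`).
* §0 `bondAvgIter_mem` (`Q_k` of `S`-valued data is `S`-valued — UST `ChartHInv.bondAvgIter_comp_apply` at the quotient map `S.mkQ`), ★ `fderiv_chartLogFlat_zero_mem`
  (`Q_lin♭ = D(chartLogFlat)(0) = ηLʲ·Q_j` preserves every ℝ-submodule; UST `fderiv_chartLogFlat_zero_apply`).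
* §1 ★★★ `chartDFlat_valued` — for a nested `D` (`D.k = k`) admissible `Adm22 D R′ M` (`2L ≤ R′`, `1 ≤ M`), the (152) weights, a ℂ-linear `H` with the sup (46) row `B₀ ≥ 0`,
  FILE α's window (`0 < ε`, `9C₂♭B₀ε < 1`, `3ε ≤ R⋆♭∕4`), an ℝ-submodule `S` with (hSH) `H` maps `S`-valued data to `S`-valued fields and (hSC) `C♭` maps `S`-valued fields of
  weighted size `< 2ε` to `S`-valued data, and ANY `Dfun` with the ball bound `‖Dfun A′ i‖ ≤ 4C₂♭ε²` and (49)♭ on the `ε`-ball: `S`-valued `A′` in the `ε`-ball ⇒ `Dfun A′` and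
  `A′ − H·Dfun A′` are `S`-valued.  ★★ `chartDFlat_valued_of_chartLogFlat` — (hSC) from the same statement for `Q♭` alone (§0 supplies the linear part).
HONEST SCOPE.  A port (the chart letters swapped for my p624568 `chartRemainderFlat_hCd_hCq`; n07-w2's proof pattern otherwise verbatim); (hSH) and (hSC) are DISPLAYED here and
discharged at `S = herm0` in CLAIM-6b; nothing of [15] asserted; `stub_prop8StepCoP13` ∕ K0⁷ NOT closed; N07 NOT discharged; no summit statement is proved by this seat; counts
unmoved (28∕28 · 5∕27); one finite 𝕋⁴ programme at fixed ε — R4 closes the conditional finite-𝕋⁴ rung only; the YM mass gap (Clay) is NOT proved by any of this.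
No `sorry`, no `def`, no `instance`, no `notation`.

References: [15] (44)–(49) pp.285–286, (50)–(55) p.286, Prop. 3 p.289, (152) p.301, (156)–(157) p.302; [Balaban1985RegularSpaces] p.93; [Balaban1988RG2Cluster] p.5 (1.13);
[Balaban1984PropagatorsI] (1.18) p.20.
-/

set_option autoImplicit false

noncomputable section

open scoped BigOperators Matrix.Norms.L2Operator
open NormedSpace Metric Set

namespace Summit.QuantumFields.YangMills.Theorems.K0Stub1FlatChartValued

open Literature.MathematicalPhysics.QuantumFieldTheory.Balaban1983to89
open B6SectADomainsV1 (Domains)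
open B6SectAOperatorsV1 (BondIdx)
open B11Eq115Space (NegSup)
open B13Contraction113 (QuadAnalytic mapsTo_T lipschitz_T)
open B8SectDSource (fixedPoint_mem_of_invariant)
open LatticeFieldCalculus (bondAvgIter)
open Summit.QuantumFields.YangMills.Theorems.FlatCubeOpsText (Adm22)
open Summit.QuantumFields.YangMills.Theorems.K0FlatCubeOpsTextP (IsLevWeight)
open Summit.QuantumFields.YangMills.Theorems.Prop8Chart (collar_of_adm22)
open Summit.QuantumFields.YangMills.Theorems.Prop8ChartDoubleBar (chartLogFlat fderiv_chartLogFlat_zero_apply)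
open Summit.QuantumFields.YangMills.Theorems.ChartHInv (bondAvgIter_comp_apply)
open Summit.QuantumFields.YangMills.Theorems.Chart47Analytic (isOpen_wBall)
open Summit.QuantumFields.YangMills.Theorems.K0Stub1FlatChartRemainderP (chartRemainderFlat_hCd_hCq)

variable {P : Params} {N : ℕ}

/-! ## §0 The linear part `Q_lin♭` preserves every value module -/

/-- `Q_k` ([Balaban1984PropagatorsI] (1.18)) of `S`-valued data is `S`-valued: read through the quotient map `S.mkQ` (UST `bondAvgIter_comp_apply`), `Q_k 0 = 0`.
[cite: Balaban1984PropagatorsI, (1.18) p.20] -/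
theorem bondAvgIter_mem (S : Submodule ℝ (Matrix (Fin N) (Fin N) ℂ)) {Y : PBond P 0 → Matrix (Fin N) (Fin N) ℂ} (hY : ∀ b, Y b ∈ S) (k : ℕ) (c : PBond P k) :
    bondAvgIter k Y c ∈ S := by
  rw [← Submodule.Quotient.mk_eq_zero, ← Submodule.mkQ_apply, ← bondAvgIter_comp_apply S.mkQ k Y c]
  have h0 : (fun b => S.mkQ (Y b)) = fun _ => (0 : Matrix (Fin N) (Fin N) ℂ ⧸ S) :=
    funext fun b => (Submodule.Quotient.mk_eq_zero S).2 (hY b)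
  rw [h0]
  have hz : ∀ (k : ℕ) (c : PBond P k), bondAvgIter k (fun _ : PBond P 0 => (0 : Matrix (Fin N) (Fin N) ℂ ⧸ S)) c = 0 := by
    intro k c
    have h := bondAvgIter_comp_apply (P := P) (0 : (Matrix (Fin N) (Fin N) ℂ ⧸ S) →ₗ[ℝ] (Matrix (Fin N) (Fin N) ℂ ⧸ S)) k (fun _ => 0) c
    simpa only [LinearMap.zero_apply] using h
  exact hz k c

/-- ★ **`Q_lin♭` OF `S`-VALUED DATA IS `S`-VALUED**: `D(chartLogFlat η D)(0) Y (j, c) = (η·Lʲ)•(Q_j Y)(c)` (UST `fderiv_chartLogFlat_zero_apply`) with a REAL scalar.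
[cite: Balaban1985Variational, (45) p.285, (156)-(157) p.302] -/
theorem fderiv_chartLogFlat_zero_mem (η : ℝ) (D : Domains P) (S : Submodule ℝ (Matrix (Fin N) (Fin N) ℂ)) {Y : PBond P 0 → Matrix (Fin N) (Fin N) ℂ}
    (hY : ∀ b, Y b ∈ S) (idx : BondIdx D) :
    (fderiv ℂ (chartLogFlat η D : (PBond P 0 → Matrix (Fin N) (Fin N) ℂ) → BondIdx D → Matrix (Fin N) (Fin N) ℂ) 0) Y idx ∈ S := by
  rw [fderiv_chartLogFlat_zero_apply, show ((η : ℂ) * ((P.L : ℕ) : ℂ) ^ (idx.1.1 : ℕ)) = ((η * (P.L : ℝ) ^ (idx.1.1 : ℕ) : ℝ) : ℂ) by push_cast; ring,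
    Complex.coe_smul]
  exact S.smul_mem _ (bondAvgIter_mem S hY _ _)

/-! ## §1 The value-module engine for the ♭ chart -/

section Engine

variable [NeZero N]

/-- ★★★ **THE IMPLICIT ♭ CHART IS `S`-VALUED ON `S`-VALUED FIELDS** — ♭ port of n07-w2's `N07ChartDValued.chartD_valued`: nested `D` (`D.k = k`), `Adm22 D R′ M` (`2L ≤ R′`,
`1 ≤ M`), the (152) weights, a ℂ-linear `H` with the sup (46) row `B₀ ≥ 0`, FILE α's window (`0 < ε`, `9C₂♭B₀ε < 1`, `3ε ≤ R⋆♭∕4`; `R⋆♭ = (60800ℓ²L)⁻¹`, `C₂♭ = 64L∕R⋆♭`), an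
ℝ-submodule `S ⊆ M_N(ℂ)` with (hSH) and (hSC) (the only arguments the iteration feeds to `C♭ = Q♭ − Q_lin♭` have weighted size `< 2ε`), and ANY `Dfun` with `‖Dfun A′ i‖ ≤ 4C₂♭ε²`
and (49)♭ on the `ε`-ball: `S`-valued `A′` in the ball ⇒ `Dfun A′` and `A′ − H·Dfun A′` are `S`-valued.  Mechanism: `X ↦ C♭(A′ − HX)` is a self-map and a `9C₂♭B₀ε`-contraction of
`‖X‖ ≤ 4C₂♭ε²` (hCq♭∕hCd♭ of p624568 on the ball `R⋆♭∕4`; `B13Contraction113`), preserving the closed set of `S`-valued data; `Dfun A′` is its fixed point there.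
[cite: Balaban1985Variational, (49)-(55) pp.285-286, Prop. 3 p.289, (152) p.301; Balaban1985RegularSpaces, p.93; Balaban1988RG2Cluster, p.5] -/
theorem chartDFlat_valued (k : ℕ) (D : Domains P) (hDk : D.k = k) {R' M : ℕ} (hAdm : Adm22 D R' M) (hR'L : 2 * P.L ≤ R') (hM : 1 ≤ M)
    {w : ℕ → PBond P 0 → ℝ} (hw : IsLevWeight P k D w)
    (H : (BondIdx D → Matrix (Fin N) (Fin N) ℂ) →ₗ[ℂ] (PBond P 0 → Matrix (Fin N) (Fin N) ℂ)) {B₀ : ℝ} (hB₀ : 0 ≤ B₀)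
    (hHB : ∀ (X : BondIdx D → Matrix (Fin N) (Fin N) ℂ) (t : ℝ), 0 ≤ t → (∀ i, ‖X i‖ ≤ t) → ∀ b, w 1 b * ‖H X b‖ ≤ B₀ * t)
    {ε : ℝ} (hε : 0 < ε)
    (hq : 9 * (64 * (P.L : ℝ) / (60800 * (((P.d + 2) * P.L : ℕ) : ℝ) ^ 2 * (P.L : ℝ))⁻¹) * B₀ * ε < 1)
    (h3ε : 3 * ε ≤ (60800 * (((P.d + 2) * P.L : ℕ) : ℝ) ^ 2 * (P.L : ℝ))⁻¹ / 4)
    (S : Submodule ℝ (Matrix (Fin N) (Fin N) ℂ))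
    (hSH : ∀ X : BondIdx D → Matrix (Fin N) (Fin N) ℂ, (∀ i, X i ∈ S) → ∀ b, H X b ∈ S)
    (hSC : ∀ Y : PBond P 0 → Matrix (Fin N) (Fin N) ℂ, (∀ b, w 1 b * ‖Y b‖ < 2 * ε) → (∀ b, Y b ∈ S) →
      ∀ i, (chartLogFlat (((P.L : ℝ)⁻¹) ^ k) D Y -
        (fderiv ℂ (chartLogFlat (((P.L : ℝ)⁻¹) ^ k) D : (PBond P 0 → Matrix (Fin N) (Fin N) ℂ) → BondIdx D → Matrix (Fin N) (Fin N) ℂ) 0) Y) i ∈ S)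
    (Dfun : (PBond P 0 → Matrix (Fin N) (Fin N) ℂ) → (BondIdx D → Matrix (Fin N) (Fin N) ℂ))
    (hDball : ∀ A' : PBond P 0 → Matrix (Fin N) (Fin N) ℂ, (∀ b, w 1 b * ‖A' b‖ < ε) →
      ∀ i, ‖Dfun A' i‖ ≤ 4 * (64 * (P.L : ℝ) / (60800 * (((P.d + 2) * P.L : ℕ) : ℝ) ^ 2 * (P.L : ℝ))⁻¹) * ε ^ 2)
    (h49 : ∀ A' : PBond P 0 → Matrix (Fin N) (Fin N) ℂ, (∀ b, w 1 b * ‖A' b‖ < ε) →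
      chartLogFlat (((P.L : ℝ)⁻¹) ^ k) D (A' - H (Dfun A')) -
        (fderiv ℂ (chartLogFlat (((P.L : ℝ)⁻¹) ^ k) D : (PBond P 0 → Matrix (Fin N) (Fin N) ℂ) → BondIdx D → Matrix (Fin N) (Fin N) ℂ) 0) (A' - H (Dfun A')) = Dfun A')
    (A' : PBond P 0 → Matrix (Fin N) (Fin N) ℂ) (hA' : ∀ b, w 1 b * ‖A' b‖ < ε) (hA'S : ∀ b, A' b ∈ S) :
    (∀ i, Dfun A' i ∈ S) ∧ ∀ b, (A' - H (Dfun A')) b ∈ S := by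
  classical
  -- names for the letters
  set η : ℝ := ((P.L : ℝ)⁻¹) ^ k with hη
  set Rs : ℝ := (60800 * (((P.d + 2) * P.L : ℕ) : ℝ) ^ 2 * (P.L : ℝ))⁻¹ with hRs_def
  set C₂ : ℝ := 64 * (P.L : ℝ) / Rs with hC₂_def
  set Qlin := (fderiv ℂ (chartLogFlat η D : (PBond P 0 → Matrix (Fin N) (Fin N) ℂ) → BondIdx D → Matrix (Fin N) (Fin N) ℂ) 0) with hQlin
  -- positivity of the letters
  have hL0 : (0 : ℝ) < P.L := lt_of_lt_of_le one_pos (by exact_mod_cast P.L_pos)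
  have hℓ0 : (0 : ℝ) < (((P.d + 2) * P.L : ℕ) : ℝ) := by exact_mod_cast Nat.pos_of_ne_zero (Nat.mul_ne_zero (by omega) (by have := P.hL.2; omega))
  have hden : 0 < 60800 * (((P.d + 2) * P.L : ℕ) : ℝ) ^ 2 * (P.L : ℝ) := by positivity
  have hRs0 : 0 < Rs := inv_pos.mpr hden
  have hC₂ : 0 ≤ C₂ := by rw [hC₂_def]; positivity
  have hwpos : ∀ b, 0 < w 1 b := fun b => by rw [hw 1 b, pow_one]; positivity
  -- hCd♭ and hCq♭ (p624568)
  obtain ⟨hCdiff, hCq⟩ := chartRemainderFlat_hCd_hCq (𝔸 := Matrix (Fin N) (Fin N) ℂ) k hR'L hM D hDk hAdm hw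
  -- the weighted carriers
  haveI hFw : Fact (∀ b : PBond P 0, 0 < w 1 b) := ⟨hwpos⟩
  haveI hF1 : Fact (∀ _ : BondIdx D, 0 < (1 : ℝ)) := ⟨fun _ => one_pos⟩
  let eY := NegSup.continuousLinearEquiv ℂ (V := Matrix (Fin N) (Fin N) ℂ) (w 1)
  let eX := NegSup.continuousLinearEquiv ℂ (V := Matrix (Fin N) (Fin N) ℂ) (fun _ : BondIdx D => (1 : ℝ))
  have hYpt : ∀ (Y : NegSup (w 1) (Matrix (Fin N) (Fin N) ℂ)) b, w 1 b * ‖eY Y b‖ ≤ ‖Y‖ := fun Y b => NegSup.weight_mul_norm_apply_le Y b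
  have hXpt : ∀ (X : NegSup (fun _ : BondIdx D => (1 : ℝ)) (Matrix (Fin N) (Fin N) ℂ)) i, ‖eX X i‖ ≤ ‖X‖ := fun X i => by
    have h := NegSup.weight_mul_norm_apply_le (w := fun _ : BondIdx D => (1 : ℝ)) X i
    rw [one_mul] at h
    exact h
  -- the nonlinear part `C♭` and the transported data
  set C : (PBond P 0 → Matrix (Fin N) (Fin N) ℂ) → (BondIdx D → Matrix (Fin N) (Fin N) ℂ) := fun Y => chartLogFlat η D Y - Qlin Y with hC
  let Ct : NegSup (w 1) (Matrix (Fin N) (Fin N) ℂ) → NegSup (fun _ : BondIdx D => (1 : ℝ)) (Matrix (Fin N) (Fin N) ℂ) := fun Y => eX.symm (C (eY Y))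
  let hop : NegSup (fun _ : BondIdx D => (1 : ℝ)) (Matrix (Fin N) (Fin N) ℂ) →ₗ[ℂ] NegSup (w 1) (Matrix (Fin N) (Fin N) ℂ) :=
    { toFun := fun X => eY.symm (H (eX X))
      map_add' := fun X X' => by simp only [map_add]
      map_smul' := fun z X => by simp only [map_smul, RingHom.id_apply] }
  have hhop_apply : ∀ X, hop X = eY.symm (H (eX X)) := fun _ => rfl
  -- (46): the transported `H` is bounded by `B₀`
  have hnormH : ∀ X, ‖hop X‖ ≤ B₀ * ‖X‖ := fun X => by
    rw [hhop_apply]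
    refine (NegSup.norm_le_iff (mul_nonneg hB₀ (norm_nonneg _))).2 fun b => ?_
    have h := hHB (eX X) ‖X‖ (norm_nonneg _) (hXpt X) b
    have hid : NegSup.equiv (w 1) (Matrix (Fin N) (Fin N) ℂ) (eY.symm (H (eX X))) b = H (eX X) b := by
      show eY (eY.symm (H (eX X))) b = H (eX X) b
      rw [ContinuousLinearEquiv.apply_symm_apply]
    rw [hid]; exact h
  -- the domain `‖Y‖ < R⋆♭∕4` is the weighted ball where hCd♭∕hCq♭ hold
  have hmapsY : ∀ Y : NegSup (w 1) (Matrix (Fin N) (Fin N) ℂ), ‖Y‖ < Rs / 4 → ∀ b, w 1 b * ‖eY Y b‖ < Rs / 4 := fun Y hY b =>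
    (hYpt Y b).trans_lt hY
  -- (44)♭: the quadratic letter in the weighted norms, and analyticity along complex lines
  have hQA : QuadAnalytic Ct C₂ (Rs / 4) := by
    refine ⟨fun Y hY => ?_, fun Y₁ Y₂ => ?_⟩
    · refine (NegSup.norm_le_iff (by positivity)).2 fun i => ?_
      rw [one_mul]
      have h := hCq (eY Y) ‖Y‖ hY (hYpt Y) i
      have hid : NegSup.equiv (fun _ : BondIdx D => (1 : ℝ)) (Matrix (Fin N) (Fin N) ℂ) (Ct Y) i = C (eY Y) i := by
        show eX (eX.symm (C (eY Y))) i = C (eY Y) i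
        rw [ContinuousLinearEquiv.apply_symm_apply]
      rw [hid]; exact h
    · intro ζ hζ
      have hline : DifferentiableAt ℂ (fun z : ℂ => eY (Y₁ + z • Y₂)) ζ :=
        eY.differentiableAt.comp ζ ((differentiableAt_const _).add (differentiableAt_id.smul_const _))
      have hpt : ∀ b, w 1 b * ‖eY (Y₁ + ζ • Y₂) b‖ < Rs / 4 := hmapsY _ hζ
      have hCd : DifferentiableAt ℂ C (eY (Y₁ + ζ • Y₂)) :=
        (hCdiff.differentiableAt ((isOpen_wBall (w 1) (Rs / 4)).mem_nhds hpt)).sub Qlin.differentiableAt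
      exact (eX.symm.differentiableAt.comp ζ (hCd.comp ζ hline)).differentiableWithinAt
  -- the windows of `B13Contraction113`
  have h9 : 9 * C₂ * B₀ * ε < 1 := hq
  have hR2 : 4 * C₂ * B₀ * ε ≤ 1 := by
    have : 0 ≤ C₂ * B₀ * ε := by positivity
    nlinarith
  have hRC2 : 2 * ε ≤ Rs / 4 := by linarith
  have hRC3 : 3 * ε ≤ Rs / 4 := h3ε
  -- the datum on the carrier
  have hA'n : ‖eY.symm A'‖ < ε :=
    (NegSup.norm_lt_iff hε).2 fun b => by
      have hid : NegSup.equiv (w 1) (Matrix (Fin N) (Fin N) ℂ) (eY.symm A') b = A' b := by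
        show eY (eY.symm A') b = A' b
        rw [ContinuousLinearEquiv.apply_symm_apply]
      rw [hid]; exact hA' b
  -- the fixed point `x := Dfun A′` read on the carrier, in the ball `4C₂♭ε²`
  set x : NegSup (fun _ : BondIdx D => (1 : ℝ)) (Matrix (Fin N) (Fin N) ℂ) := eX.symm (Dfun A') with hx_def
  have heXx' : eX x = Dfun A' := by rw [hx_def, ContinuousLinearEquiv.apply_symm_apply]
  have heXx : ∀ i, eX x i = Dfun A' i := fun i => by rw [heXx']
  have hx : ‖x‖ ≤ 4 * C₂ * ε ^ 2 := by
    refine (NegSup.norm_le_iff (by positivity)).2 fun i => ?_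
    rw [one_mul]
    show ‖eX x i‖ ≤ 4 * C₂ * ε ^ 2
    rw [heXx]
    exact hDball A' hA' i
  -- reading the iteration map back on plain functions
  have hread : ∀ X : NegSup (fun _ : BondIdx D => (1 : ℝ)) (Matrix (Fin N) (Fin N) ℂ), ∀ i, eX (Ct (eY.symm A' - hop X)) i = C (A' - H (eX X)) i := by
    intro X i
    show eX (eX.symm (C (eY (eY.symm A' - eY.symm (H (eX X)))))) i = C (A' - H (eX X)) i
    rw [ContinuousLinearEquiv.apply_symm_apply, map_sub, ContinuousLinearEquiv.apply_symm_apply, ContinuousLinearEquiv.apply_symm_apply]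
  have hfix : Ct (eY.symm A' - hop x) = x := by
    apply eX.injective
    funext i
    rw [hread, heXx']
    have hfun := congrFun (h49 A' hA') i
    simpa only [hC] using hfun
  -- the closed invariant set of `S`-valued data
  set T : Set (NegSup (fun _ : BondIdx D => (1 : ℝ)) (Matrix (Fin N) (Fin N) ℂ)) := {X | ∀ i, eX X i ∈ S} with hT
  have hTclosed : IsClosed T := by
    have hrepr : T = ⋂ i, (fun X : NegSup (fun _ : BondIdx D => (1 : ℝ)) (Matrix (Fin N) (Fin N) ℂ) => eX X i) ⁻¹' (S : Set (Matrix (Fin N) (Fin N) ℂ)) := by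
      ext X; simp only [hT, Set.mem_setOf_eq, Set.mem_iInter, Set.mem_preimage, SetLike.mem_coe]
    rw [hrepr]
    exact isClosed_iInter fun i => (S.closed_of_finiteDimensional).preimage ((continuous_apply i).comp eX.continuous)
  have hT0 : (0 : NegSup (fun _ : BondIdx D => (1 : ℝ)) (Matrix (Fin N) (Fin N) ℂ)) ∈ T := fun i => by
    rw [map_zero]; exact S.zero_mem
  -- self-map, contraction, invariance on the ball
  have hmaps := mapsTo_T (A' := eY.symm A') hQA hC₂ hB₀ hnormH hA'n hR2 hRC2
  have hinv : ∀ X ∈ T, ‖X‖ ≤ 4 * C₂ * ε ^ 2 → Ct (eY.symm A' - hop X) ∈ T := by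
    intro X hXT hXn i
    rw [hread]
    -- the argument `A′ − H(eX X)` is `S`-valued and of weighted size `< 2ε`
    have hHX : ∀ b, w 1 b * ‖H (eX X) b‖ ≤ B₀ * (4 * C₂ * ε ^ 2) := fun b =>
      hHB (eX X) (4 * C₂ * ε ^ 2) (by positivity) (fun j => (hXpt X j).trans hXn) b
    have hsize : ∀ b, w 1 b * ‖(A' - H (eX X)) b‖ < 2 * ε := fun b => by
      rw [Pi.sub_apply]
      have h1 : w 1 b * ‖A' b - H (eX X) b‖ ≤ w 1 b * ‖A' b‖ + w 1 b * ‖H (eX X) b‖ := by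
        rw [← mul_add]; exact mul_le_mul_of_nonneg_left (norm_sub_le _ _) (hwpos b).le
      have h2' : B₀ * (4 * C₂ * ε ^ 2) ≤ ε := by
        have : B₀ * (4 * C₂ * ε ^ 2) = (4 * C₂ * B₀ * ε) * ε := by ring
        rw [this]; nlinarith
      linarith [hA' b, hHX b]
    exact hSC _ hsize (fun b => S.sub_mem (hA'S b) (hSH _ hXT b)) i
  have hmem : x ∈ T :=
    fixedPoint_mem_of_invariant (fun X => Ct (eY.symm A' - hop X)) (by positivity) (by positivity) h9
      (fun X hX => by
        have h := hmaps (mem_closedBall_zero_iff.2 hX)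
        exact mem_closedBall_zero_iff.1 h)
      (fun X₁ X₂ h₁ h₂ => lipschitz_T (A' := eY.symm A') hQA hC₂ hB₀ hnormH hA'n hR2 hRC3
        (mem_closedBall_zero_iff.2 h₁) (mem_closedBall_zero_iff.2 h₂))
      T hTclosed hT0 hinv hx hfix
  have hDS : ∀ i, Dfun A' i ∈ S := fun i => by rw [← heXx]; exact hmem i
  exact ⟨hDS, fun b => by rw [Pi.sub_apply]; exact S.sub_mem (hA'S b) (hSH _ hDS b)⟩

/-- ★★ **(hSC) FROM THE ♭ CHART ALONE**: since `Q_lin♭` preserves every value module (§0), hypothesis (hSC) of `chartDFlat_valued` reduces to (hSlog♭): `Q♭` maps `S`-valued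
fields of weighted size `< 2ε` to `S`-valued data (at `S = herm0`: FILE CLAIM-5's `⋆`-symmetry and CLAIM-6b's trace row). [cite: Balaban1985Variational, (47)-(49) pp.285-286, (152) p.301] -/
theorem chartDFlat_valued_of_chartLogFlat (k : ℕ) (D : Domains P) (hDk : D.k = k) {R' M : ℕ} (hAdm : Adm22 D R' M) (hR'L : 2 * P.L ≤ R') (hM : 1 ≤ M)
    {w : ℕ → PBond P 0 → ℝ} (hw : IsLevWeight P k D w)
    (H : (BondIdx D → Matrix (Fin N) (Fin N) ℂ) →ₗ[ℂ] (PBond P 0 → Matrix (Fin N) (Fin N) ℂ)) {B₀ : ℝ} (hB₀ : 0 ≤ B₀)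
    (hHB : ∀ (X : BondIdx D → Matrix (Fin N) (Fin N) ℂ) (t : ℝ), 0 ≤ t → (∀ i, ‖X i‖ ≤ t) → ∀ b, w 1 b * ‖H X b‖ ≤ B₀ * t)
    {ε : ℝ} (hε : 0 < ε)
    (hq : 9 * (64 * (P.L : ℝ) / (60800 * (((P.d + 2) * P.L : ℕ) : ℝ) ^ 2 * (P.L : ℝ))⁻¹) * B₀ * ε < 1)
    (h3ε : 3 * ε ≤ (60800 * (((P.d + 2) * P.L : ℕ) : ℝ) ^ 2 * (P.L : ℝ))⁻¹ / 4)
    (S : Submodule ℝ (Matrix (Fin N) (Fin N) ℂ))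
    (hSH : ∀ X : BondIdx D → Matrix (Fin N) (Fin N) ℂ, (∀ i, X i ∈ S) → ∀ b, H X b ∈ S)
    (hSlog : ∀ Y : PBond P 0 → Matrix (Fin N) (Fin N) ℂ, (∀ b, w 1 b * ‖Y b‖ < 2 * ε) → (∀ b, Y b ∈ S) →
      ∀ i, chartLogFlat (((P.L : ℝ)⁻¹) ^ k) D Y i ∈ S)
    (Dfun : (PBond P 0 → Matrix (Fin N) (Fin N) ℂ) → (BondIdx D → Matrix (Fin N) (Fin N) ℂ))
    (hDball : ∀ A' : PBond P 0 → Matrix (Fin N) (Fin N) ℂ, (∀ b, w 1 b * ‖A' b‖ < ε) →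
      ∀ i, ‖Dfun A' i‖ ≤ 4 * (64 * (P.L : ℝ) / (60800 * (((P.d + 2) * P.L : ℕ) : ℝ) ^ 2 * (P.L : ℝ))⁻¹) * ε ^ 2)
    (h49 : ∀ A' : PBond P 0 → Matrix (Fin N) (Fin N) ℂ, (∀ b, w 1 b * ‖A' b‖ < ε) →
      chartLogFlat (((P.L : ℝ)⁻¹) ^ k) D (A' - H (Dfun A')) -
        (fderiv ℂ (chartLogFlat (((P.L : ℝ)⁻¹) ^ k) D : (PBond P 0 → Matrix (Fin N) (Fin N) ℂ) → BondIdx D → Matrix (Fin N) (Fin N) ℂ) 0) (A' - H (Dfun A')) = Dfun A')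
    (A' : PBond P 0 → Matrix (Fin N) (Fin N) ℂ) (hA' : ∀ b, w 1 b * ‖A' b‖ < ε) (hA'S : ∀ b, A' b ∈ S) :
    (∀ i, Dfun A' i ∈ S) ∧ ∀ b, (A' - H (Dfun A')) b ∈ S :=
  chartDFlat_valued k D hDk hAdm hR'L hM hw H hB₀ hHB hε hq h3ε S hSH
    (fun Y hY hYS i => by rw [Pi.sub_apply]; exact S.sub_mem (hSlog Y hY hYS i) (fderiv_chartLogFlat_zero_mem _ D S hYS i))
    Dfun hDball h49 A' hA' hA'S

end Engine

end Summit.QuantumFields.YangMills.Theorems.K0Stub1FlatChartValued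

end
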